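import Mathlib
import HarnessLib
import Summits.HubbardSuperconductivity.HubbardSuperconductivity.Theorems.ComplexGFFStiffnessHypACumulantPertZBasic
import Summits.HubbardSuperconductivity.HubbardSuperconductivity.Theorems.ComplexGFFStiffnessHypACumulantStubGnvOfFrd

/-!
# Crux `HypACumulant`, line `gnv` — POSITIVITY of the perturbed partition function on the
# `ι`-admissible ball: `0 < Re pertZ n K`, `Im pertZ n K = 0`, uniformly along the tower

Route `route-HubbardSuperconductivity-ComplexGFFStiffness`, cruxes stmt-HubbardSuperconductivity-19154 /
-19155, shared research statement `OnePointLipschitz`, census entry (C4) of `TWOPOINT-PLAN-cgffstiff2-g0.md`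
(the finite-volume free energy `f(K) = |Λ|⁻¹ log pertZ n K` along the tuned flow is a REAL logarithm of a
POSITIVE number — no branch is ever chosen).  By `ι`-symmetry `pertZ n K` is real (`pertZ_im`); along the
segment `θ ↦ θ·K`, `θ ∈ [0,1]`, which stays in every `ι`-admissible ball, `θ ↦ Re pertZ n (θ·K)` is
continuous (dominated convergence, `‖∏(1+θK)‖ ≤ (1+ρ)^{|Λ|} e^{S_0/2}`), starts at `Z_n(0,0) > 0`
(`pertZ_zero_pos`) and never vanishes when `pertZ ≠ 0` on the ball — so it stays positive
(intermediate value theorem).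

* `isIotaAdmissible_smul` — `θ·K` is `ι`-admissible with the same data for `θ ∈ [0,1]`;
* `continuousOn_pertZ_smul` — `θ ↦ pertZ n (θ·K)` is continuous on `|θ| ≤ 1`;
* `pertZ_re_pos_of_ne_zero_on_segment` — non-vanishing along the segment ⟹ `0 < Re pertZ n K`;
* **`pertZ_re_pos_of_gnv`**, **`pertZ_re_pos`** — with `GNV` (a theorem of the tree, `gnv`): there are `r₀`,
  `L₀` and for every odd `L ≥ L₀` a radius `ρ > 0` such that `0 < Re pertZ n K` and `Im pertZ n K = 0`
  for all `N ≥ 1`, `n = L^N` and all `ι`-admissible `K` with data `(r₀, ρ)`.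

All proved, no `sorry`; nothing here bears on the Hubbard model beyond the crux's bookkeeping.

## References
* S. Adams, S. Buchholz, R. Kotecký, S. Müller, arXiv:1910.13564, Sec. 2.1 / Ch. 4 (the perturbative
  partition function `𝒵_N(𝒦)` and its logarithm `𝒲_N`) [AdamsBuchholzKoteckyMuller2019].
-/

noncomputable section

-- `Summit.<Summit>.<Problem>`: single-conjunct summit, the duplicate component is mandated (D-0017).
set_option linter.dupNamespace false

namespace Summit.HubbardSuperconductivity.HubbardSuperconductivity.Theorems.ComplexGFF

open scoped BigOperators ComplexConjugate
open MeasureTheory Set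
open Literature.MathematicalPhysics.StatisticalMechanics.ComplexGradientGFF4 (Z ev Y D S X w Z_zero_zero_pos)

variable {n : ℕ}

/-! ### The segment `θ ↦ θ·K` stays in the admissible ball -/

/-- `θ·K` is `ι`-admissible with the same data as `K` for `0 ≤ θ ≤ 1`. -/
theorem isIotaAdmissible_smul {r₀ : ℕ} {ρ : ℝ} {K : (Fin 4 → ℝ) → ℂ} (hK : IsIotaAdmissible r₀ ρ K)
    {θ : ℝ} (hθ0 : 0 ≤ θ) (hθ1 : θ ≤ 1) :
    IsIotaAdmissible r₀ ρ (fun z => (θ : ℂ) * K z) := by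
  obtain ⟨hd, hb, hι⟩ := hK
  have e : (fun z => (θ : ℂ) * K z) = fun z => (θ : ℂ) • K z := by funext z; rw [smul_eq_mul]
  refine ⟨?_, fun k hk z => ?_, fun z => ?_⟩
  · rw [e]; exact hd.const_smul (θ : ℂ)
  · have hk' : (k : WithTop ℕ∞) ≤ r₀ := by exact_mod_cast hk
    rw [e, iteratedFDeriv_const_smul_apply' ((hd.of_le hk').contDiffAt), norm_smul, Complex.norm_real,
      Real.norm_eq_abs, abs_of_nonneg hθ0]
    calc θ * ‖iteratedFDeriv ℝ k K z‖ ≤ 1 * ‖iteratedFDeriv ℝ k K z‖ :=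
        mul_le_mul_of_nonneg_right hθ1 (norm_nonneg _)
      _ ≤ ρ * Real.exp ((∑ i : Fin 4, (z i) ^ 2) / 4) := by rw [one_mul]; exact hb k hk z
  · show (θ : ℂ) * K (-z) = conj ((θ : ℂ) * K z)
    rw [hι z, map_mul, Complex.conj_ofReal]

/-- the order-zero bound of an admissible `K` (from the `k = 0` derivative clause). -/
theorem norm_le_of_isIotaAdmissible {r₀ : ℕ} {ρ : ℝ} {K : (Fin 4 → ℝ) → ℂ} (hK : IsIotaAdmissible r₀ ρ K)
    (z : Fin 4 → ℝ) : ‖K z‖ ≤ ρ * Real.exp ((∑ i : Fin 4, (z i) ^ 2) / 4) := by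
  have h := hK.2.1 0 (Nat.zero_le _) z
  rwa [norm_iteratedFDeriv_zero] at h

/-! ### Continuity of `θ ↦ pertZ n (θ·K)` -/

/-- **Continuity along the segment:** for continuous `K` with `‖K(z)‖ ≤ ρ e^{Σ z_i²/4}`,
`θ ↦ pertZ n (θ·K)` is continuous on `[0,1]` (indeed on `{|θ| ≤ 1}`; dominated convergence). -/
theorem continuousOn_pertZ_smul [NeZero n] {K : (Fin 4 → ℝ) → ℂ} (hKc : Continuous K) {ρ : ℝ} (hρ : 0 ≤ ρ)
    (hK : ∀ z : Fin 4 → ℝ, ‖K z‖ ≤ ρ * Real.exp ((∑ i : Fin 4, (z i) ^ 2) / 4)) :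
    ContinuousOn (fun θ : ℝ => pertZ n (fun z => (θ : ℂ) * K z)) (Icc (-1) 1) := by
  have hD : ∀ (i : Fin 4) (x : Fin 4 → ZMod n),
      Continuous (fun φ : (Fin 4 → ZMod n) → ℝ => D φ i x) := fun i x => by unfold D; fun_prop
  have hS : Continuous (fun φ : (Fin 4 → ZMod n) → ℝ => S 0 φ) := by unfold S D; fun_prop
  -- the parametrised integrand
  set F : ℝ → ((Fin 4 → ZMod n) → ℝ) → ℂ := fun θ φ =>
    Complex.exp (-((S 0 φ : ℝ) : ℂ)) * ∏ x : Fin 4 → ZMod n, (1 + (θ : ℂ) * K (fun i => D φ i x)) with hF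
  have hpertZ : ∀ θ : ℝ, pertZ n (fun z => (θ : ℂ) * K z) = ∫ φ, F θ φ := fun θ => rfl
  -- joint continuity of the integrand
  have hcont : Continuous (Function.uncurry F) := by
    simp only [hF, Function.uncurry_def]
    refine Continuous.mul ?_ ?_
    · exact Complex.continuous_exp.comp (Complex.continuous_ofReal.comp (hS.comp continuous_snd)).neg
    · refine continuous_finsetProd _ (fun x _ => continuous_const.add ?_)
      refine (Complex.continuous_ofReal.comp continuous_fst).mul (hKc.comp ?_)
      exact continuous_pi (fun i => (hD i x).comp continuous_snd)
  -- domination on `|θ| ≤ 1` by `(1+ρ)^{|Λ|} e^{−S/2}`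
  have hbound : ∀ θ ∈ Icc (-1 : ℝ) 1, ∀ φ : (Fin 4 → ZMod n) → ℝ,
      ‖F θ φ‖ ≤ (1 + ρ) ^ Fintype.card (Fin 4 → ZMod n) * Real.exp (-(S 0 φ) / 2) := by
    intro θ hθ φ
    have hθ1 : |θ| ≤ 1 := abs_le.mpr ⟨hθ.1, hθ.2⟩
    have hKθ : ∀ z : Fin 4 → ℝ, ‖(θ : ℂ) * K z‖ ≤ ρ * Real.exp ((∑ i : Fin 4, (z i) ^ 2) / 4) := by
      intro z
      rw [norm_mul, Complex.norm_real, Real.norm_eq_abs]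
      calc |θ| * ‖K z‖ ≤ 1 * ‖K z‖ := mul_le_mul_of_nonneg_right hθ1 (norm_nonneg _)
        _ ≤ ρ * Real.exp ((∑ i : Fin 4, (z i) ^ 2) / 4) := by rw [one_mul]; exact hK z
    have hprod := norm_prod_one_add_le (n := n) hρ hKθ φ
    simp only [hF]
    rw [norm_mul, Complex.norm_exp]
    have hre : (-((S 0 φ : ℝ) : ℂ)).re = -(S 0 φ) := by simp
    rw [hre]
    calc Real.exp (-(S 0 φ)) * ‖∏ x : Fin 4 → ZMod n, (1 + (θ : ℂ) * K (fun i => D φ i x))‖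
        ≤ Real.exp (-(S 0 φ)) * ((1 + ρ) ^ Fintype.card (Fin 4 → ZMod n) * Real.exp (S 0 φ / 2)) :=
          mul_le_mul_of_nonneg_left hprod (Real.exp_pos _).le
      _ = (1 + ρ) ^ Fintype.card (Fin 4 → ZMod n) * Real.exp (-(S 0 φ) / 2) := by
          have : Real.exp (-(S 0 φ)) * Real.exp (S 0 φ / 2) = Real.exp (-(S 0 φ) / 2) := by
            rw [← Real.exp_add]; congr 1; ring
          rw [← this]; ring
  have hint : Integrable (fun φ : (Fin 4 → ZMod n) → ℝ =>
      (1 + ρ) ^ Fintype.card (Fin 4 → ZMod n) * Real.exp (-(S 0 φ) / 2)) :=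
    (integrable_exp_neg_half_S n).const_mul _
  have h := continuousOn_of_dominated (F := F) (μ := volume) (s := Icc (-1 : ℝ) 1)
    (bound := fun φ => (1 + ρ) ^ Fintype.card (Fin 4 → ZMod n) * Real.exp (-(S 0 φ) / 2))
    (fun θ _ => (hcont.comp (Continuous.prodMk_right θ)).aestronglyMeasurable)
    (fun θ hθ => Filter.Eventually.of_forall (hbound θ hθ)) hint
    (Filter.Eventually.of_forall (fun φ => (hcont.comp (Continuous.prodMk_left φ)).continuousOn))
  simpa [hpertZ] using h

/-! ### Positivity -/

/-- **Positivity from non-vanishing along the segment.** If `K` is continuous, `ι`-symmetric, of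
order-zero size `ρ`, and `pertZ n (θ·K) ≠ 0` for all `θ ∈ [0,1]`, then `0 < Re pertZ n K`. -/
theorem pertZ_re_pos_of_ne_zero_on_segment [NeZero n] {K : (Fin 4 → ℝ) → ℂ} (hKc : Continuous K)
    {ρ : ℝ} (hρ : 0 ≤ ρ) (hK : ∀ z : Fin 4 → ℝ, ‖K z‖ ≤ ρ * Real.exp ((∑ i : Fin 4, (z i) ^ 2) / 4))
    (hι : ∀ z : Fin 4 → ℝ, K (-z) = conj (K z))
    (hne : ∀ θ : ℝ, θ ∈ Icc (0 : ℝ) 1 → pertZ n (fun z => (θ : ℂ) * K z) ≠ 0) :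
    0 < (pertZ n K).re := by
  set g : ℝ → ℝ := fun θ => (pertZ n (fun z => (θ : ℂ) * K z)).re with hg
  have hgc : ContinuousOn g (Icc (0 : ℝ) 1) :=
    (Complex.continuous_re.comp_continuousOn (continuousOn_pertZ_smul hKc hρ hK)).mono
      (Icc_subset_Icc (by norm_num) le_rfl)
  have hιθ : ∀ θ : ℝ, ∀ z : Fin 4 → ℝ, (θ : ℂ) * K (-z) = conj ((θ : ℂ) * K z) := fun θ z => by
    rw [hι z, map_mul, Complex.conj_ofReal]
  -- `g θ ≠ 0` on `[0,1]` (the value is real and nonzero)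
  have hgne : ∀ θ ∈ Icc (0 : ℝ) 1, g θ ≠ 0 := by
    intro θ hθ h0
    apply hne θ hθ
    apply Complex.ext
    · simpa [hg] using h0
    · rw [pertZ_im n (hιθ θ), Complex.zero_im]
  -- `g 0 > 0`
  have hg0 : 0 < g 0 := by
    have e : (fun z : Fin 4 → ℝ => ((0 : ℝ) : ℂ) * K z) = fun _ => 0 := by funext z; simp
    simp only [hg, e]
    exact (pertZ_zero_pos n).1
  -- `g 1 = Re pertZ n K`
  have hg1 : g 1 = (pertZ n K).re := by
    simp only [hg, Complex.ofReal_one, one_mul]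
  rw [← hg1]
  by_contra hle
  push Not at hle
  -- intermediate value: `0 ∈ [g 1, g 0] ⊆ g '' [0,1]`
  have hmem : (0 : ℝ) ∈ Icc (g 1) (g 0) := ⟨hle, hg0.le⟩
  obtain ⟨θ, hθ, hθ0⟩ := intermediate_value_Icc' (zero_le_one' ℝ) hgc hmem
  exact hgne θ hθ hθ0

/-- **Positivity on the admissible ball from `GNV`.**  [cite: AdamsBuchholzKoteckyMuller2019, Thm 2.2] -/
theorem pertZ_re_pos_of_gnv (h : GNV) :
    ∃ r₀ : ℕ, ∃ L₀ : ℕ, ∀ L : ℕ, Odd L → L₀ ≤ L → ∃ ρ : ℝ, 0 < ρ ∧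
      ∀ N : ℕ, 1 ≤ N → ∀ (n : ℕ) [NeZero n], n = L ^ N →
        ∀ K : (Fin 4 → ℝ) → ℂ, IsIotaAdmissible r₀ ρ K → 0 < (pertZ n K).re ∧ (pertZ n K).im = 0 := by
  obtain ⟨r₀, L₀, hL⟩ := h
  refine ⟨r₀, L₀, fun L hLodd hle => ?_⟩
  obtain ⟨ρ, hρ, hmain⟩ := hL L hLodd hle
  refine ⟨ρ, hρ, fun N hN n _ hn K hK => ⟨?_, pertZ_im n hK.2.2⟩⟩
  refine pertZ_re_pos_of_ne_zero_on_segment (hK.1.continuous) hρ.le (norm_le_of_isIotaAdmissible hK) hK.2.2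
    (fun θ hθ => hmain N hN n hn _ (isIotaAdmissible_smul hK hθ.1 hθ.2))

/-- **Positivity on the admissible ball, unconditionally** (`GNV` is the theorem `gnv` of the tree): there
are `r₀`, `L₀` and for every odd `L ≥ L₀` a radius `ρ > 0` with `0 < Re pertZ n K`, `Im pertZ n K = 0` for all
`N ≥ 1`, `n = L^N` and all `ι`-admissible `K` with data `(r₀, ρ)`. [cite: AdamsBuchholzKoteckyMuller2019, Thm 2.2] -/
theorem pertZ_re_pos :
    ∃ r₀ : ℕ, ∃ L₀ : ℕ, ∀ L : ℕ, Odd L → L₀ ≤ L → ∃ ρ : ℝ, 0 < ρ ∧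
      ∀ N : ℕ, 1 ≤ N → ∀ (n : ℕ) [NeZero n], n = L ^ N →
        ∀ K : (Fin 4 → ℝ) → ℂ, IsIotaAdmissible r₀ ρ K → 0 < (pertZ n K).re ∧ (pertZ n K).im = 0 :=
  pertZ_re_pos_of_gnv gnv

end Summit.HubbardSuperconductivity.HubbardSuperconductivity.Theorems.ComplexGFF

end
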